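import Summits.CriticalPhenomena.PercolationContinuityZ3.Theses.PercBudgetLadder
import Summits.CriticalPhenomena.PercolationContinuityZ3.Theses.PercAnnulusCrossing
import Literature.Probability.Percolation.MinOpenCut
import Literature.Probability.Percolation.CriticalContinuityProofs
import Literature.Probability.Percolation.SiteConnectionTools
import Literature.Probability.Percolation.DeletionTolerance

/-!
# Disproof of `PinholeClosing` (crux r3 of route PercBudgetLadder, item stmt-CriticalPhenomena-5249) — findings

Standing-adversary work file (gen 1: refuter-cdisprove-stmt-CriticalPhenomena-5249-0, §0–§6; gen 2:
refuter-cdisprove-stmt-CriticalPhenomena-5249-g2-0, §7).  Prose lives in docstrings only.  Contents: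

* §0 Dictionary: `blockedEv k n m` / `blockProb k n m` = the budget-`k` blocked event / probability of the
  annulus `box 3 n → ∂ box 3 m` inside `box 3 m` at `p_c(ℤ³)`; `pinholeClosing_iff`, `budgetTightness_iff`
  (`Iff.rfl` restatements of the route decls).
* §1b The trivial rung (`blockProb_succ_le`, `pinholeClosing_baseline`): by locality + deletion tolerance +
  a union bound over the pinhole position, `P(MinCut ≤ k+1) ≤ (1 + #edgesIn(box m)/(1-p_c)) P(MinCut ≤ k)`, so
  the crux HOLDS with the non-uniform constant `c'(n) = c(1-p_c)/(1-p_c+#edgesIn(box(l n))) ≍ c n⁻³`; the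
  content of r3 is exactly the removal of this entropy factor (uniformity in n).
* §1 Elementary facts every attack runs into: `blockedEv_eq_empty` (`m ≤ n`: the event is EMPTY — reflexive
  crossing), `blockProb_pos` (`n < m`: the event has probability ≥ (1-p_c)^{#edges touching box n} > 0 —
  finite energy), `blockProb_mono_budget`, `blockProb_mono_aspect` (longer annuli are easier to block, a.s.).
* §2 LOAD-BEARING ANALYSIS (`…Without…` defs + theorems): the guards `2 ≤ l` and `1 ≤ n` are NOT
  load-bearing (`pinholeClosingWithoutL_iff`, `pinholeClosingWithoutN_iff`: dropping them gives an
  equivalent statement, the new instances having an empty premise event); `0 < c'` is the whole content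
  (`pinholeClosingWithoutCpos` is trivially true); dropping `0 < c` (or the premise) upgrades the crux to
  UNIFORM budget-k blocking for every k (`pinholeClosingWithoutC_iff`), which at k = 0 already implies the
  route target — so the premise is what keeps r3 below X.
* §3 WHY IT RESISTS (no kill available): `pinholeClosing_of_not_budgetTightness` (¬r2 → r3: if critical
  budgets diverge, the premise of r3 fails eventually and c' is a finite minimum of positive numbers) and
  `pinholeClosing_of_critAnnulusNonCrossing` (X_B of route PercAnnulusCrossing → r3 with c' = the RSW
  constant; more generally `pinholeClosing_of_uniform_blocking`: any uniform blocking bound at aspect ≤ 4).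
  Dimension remark (not formalised): the d-dimensional analogue is TRUE in d = 2 (RSW closed dual circuits
  block every annulus with probability ≥ c(aspect)) and vacuously TRUE for d > 6 under η = 0 (budgets diverge,
  barrier SpanningClustersAboveSix ⇒ premise eventually false), so no dimension-uniform refutation exists
  either; the statement is believed in every d and carries d = 3 information only jointly with r2.  Hence `not_pinholeClosing_imp`: ¬r3 → (r2 ∧ ¬X_B): a refutation of PinholeClosing would at once
  PROVE bounded-budget tightness at p_c(ℤ³) and REFUTE the uniform critical-annulus RSW bound — two open
  problems; no finite computation, degenerate instance or catalogued barrier can do that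
  (`kill_criterion`: the refuting n are necessarily unbounded).
* §4 The crux is stronger than the Assembly needs: `PinholeClosingIO` (i.o. premise → i.o. conclusion) with
  `pinholeClosingIO_of_pinholeClosing` and `closes_of_io` (the route closes from r2 + the i.o. form); any fixed
  expansion factor λ ≥ 2 in place of 2 would do as well (remark).
* §4b `cruxes_squeeze`: X(aspect ≤ 4) ⟹ (r2 ∧ r3_IO) ⟹ X — given r2, the i.o. form of r3 is EQUIVALENT to the
  target up to aspect bookkeeping; the decomposition isolates necessary halves, it is not a reduction to an
  easier statement.
* §5 The pointwise (deterministic) strengthening is FALSE (`not_pointwisePinholeClosing`): the single open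
  filament `ray` has budget 1 at every aspect and is never blocked at budget 0 — the deterministic caricature
  of the "jump world"; r3's content is probabilistic (P_{p_c} must not charge such filaments uniformly).
* §7 LINE `halfspace-polarisation` (the lead's registered skeleton, stubs def-free rev 2): the four "provable now"
  stubs (pinholeBehindPlane, signedSymmetry, harrisTiles, slabTiling) were re-derived on paper by the disprover and
  found TRUE AS TYPED (no typing defect survives the lattice guard of stub 5; the grid rounding `|w_j| ≤ l` holds for
  ALL n, l; `0 ≤ c` in stub 4 is needed — `c = -2` would falsify it — and present).  The OPEN stub
  `stub_halfspaceShare` (= `HalfspaceShare` here, `halfspaceShare_iff` is `Iff.rfl`) RESISTS EXACTLY LIKE THE CRUX: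
  `frontProb_pos` (finite energy: per-n free), `halfspaceShare_of_not_budgetTightness` (¬r2 → stub),
  `halfspaceShare_of_uniform` (uniform half-space blocking → stub, premise unused), hence `not_halfspaceShare_imp`:
  a refutation of the stub PROVES r2 and REFUTES uniform half-space RSW; `halfspaceShare_kill_criterion` (refuting n
  unbounded, every admissible radius must fail); `not_pointwiseHalfspaceShare` (the configurationwise version is false:
  the filament `ray` has budget 1 and front-crosses every half-box); `frontBlocked₀_mono_aspect` (a.s. monotone in the
  outer radius, walk surgery on the front part `frontPart ω`) whence `halfspaceShare_iff_top`: WLOG `L' = 2ln - n - 1`,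
  the stub is ONE half-box bound per n; `frontBlocked₀_eq_empty` (`L ≤ n`: empty event — the guard `l n ≤ L'` matters).
  §7.5: the lead's MECHANISM `EccentricShare` (centred form `EccentricShare₀`, back-polarised budget-(k+2) blocking)
  has the same shape — budget-0 blocking is polar blocking with `S = ∅`, so `eccentricShare₀_of_uniform_blocking`,
  `eccentricShare₀_of_not_budgetTightness`, `not_eccentricShare₀_imp`: refuting the mechanism is no easier than
  refuting the stub (¬ ⇒ r2 ∧ ¬uniform budget-0 blocking).
* §6 Numerics (evidence only, kit j008606): joint law of (MinCut(n, l n), MinCut(n, 2 l n)) at p = 0.2488126 —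
  in r3's premise regime (aspects 4–16, k ≤ 2) the conclusion probabilities are STABLE in n
  (P(MinCut(n,8n)=0) ≈ 0.07, P(MinCut(n,16n)=0) ≈ 0.27) while premise probabilities shrink: r3 numerically
  comfortable; budgets flat at aspects 8/16, slow (possibly transient, possibly log) growth at aspect 2.
-/

namespace Summit.CriticalPhenomena.PercolationContinuityZ3.Cruxes.PinholeClosing.Disproof

open MeasureTheory Filter
open Literature.Probability.Percolation Literature.Probability.LatticeModels
open Summit.CriticalPhenomena.PercolationContinuityZ3.Theses

noncomputable section

/-! ## §0 Dictionary -/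

/-- The critical bond percolation measure `P_{p_c}` on `ℤ³`. [folklore] -/
abbrev μc : Measure (BondConfig (Site 3)) := bondPercolation (zdGraph 3) (criticalProbI 3)

/-- The budget-`k` blocked event of the annulus `box 3 n → ∂ⁱⁿ box 3 m` inside `box 3 m`: closing some
`≤ k` edges leaves no open crossing (verbatim the set-builder of the route items). [folklore] -/
def blockedEv (k n m : ℕ) : Set (BondConfig (Site 3)) :=
  {ω | ∃ S : Finset (Sym2 (Site 3)), S.card ≤ k ∧ ¬ ∃ x ∈ box 3 n,
    ∃ y ∈ innerBoundary (zdGraph 3) (box 3 m), (ω \ ↑S) ∈ openConnIn ↑(box 3 m) x y}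

/-- `blockProb k n m = P_{p_c}(blockedEv k n m)`. [folklore] -/
def blockProb (k n m : ℕ) : ℝ := μc.real (blockedEv k n m)

/-- The crux, restated over the dictionary (definitional). [folklore] -/
theorem pinholeClosing_iff :
    PercBudgetLadder.PinholeClosing ↔
      ∀ (k l : ℕ) (c : ℝ), 2 ≤ l → 0 < c → ∃ c' : ℝ, 0 < c' ∧ ∀ n : ℕ, 1 ≤ n →
        c ≤ blockProb (k + 1) n (l * n) → c' ≤ blockProb k n (2 * l * n) :=
  Iff.rfl

/-- Crux r2, restated over the dictionary (definitional). [folklore] -/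
theorem budgetTightness_iff :
    PercBudgetLadder.BudgetTightness ↔
      ∃ (k l : ℕ) (c : ℝ), 2 ≤ l ∧ 0 < c ∧ ∀ N : ℕ, ∃ n : ℕ, N ≤ n ∧ c ≤ blockProb k n (l * n) :=
  Iff.rfl

/-! ## §1 Elementary facts -/

/-- The corner `(m,m,m)` lies on the inner vertex boundary of `box 3 m`; in particular it is nonempty.
[folklore] -/
theorem corner_mem_innerBoundary (m : ℕ) :
    (fun _ => (m : ℤ)) ∈ innerBoundary (zdGraph 3) (box 3 m) := by
  rw [mem_innerBoundary_iff]
  refine ⟨by simp [mem_box], (fun _ => (m : ℤ)) + Pi.single 0 1, ?_, ?_⟩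
  · simp only [mem_box, not_forall, not_and, not_le]
    exact ⟨0, fun _ => by simp⟩
  · rw [zdGraph_adj_iff]
    exact ⟨0, Or.inl rfl⟩

/-- A vertex of `∂ⁱⁿ box 3 m` has a coordinate equal to `±m`, hence lies outside `box 3 n` for `n < m`.
[folklore] -/
theorem notMem_box_of_mem_innerBoundary {n m : ℕ} (h : n < m) {y : Site 3}
    (hy : y ∈ innerBoundary (zdGraph 3) (box 3 m)) : y ∉ box 3 n := by
  obtain ⟨i, hi | hi⟩ := exists_eq_of_mem_innerBoundary_box hy
  · rw [mem_box, not_forall]; exact ⟨i, by omega⟩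
  · rw [mem_box, not_forall]; exact ⟨i, by omega⟩

/-- A vertex of `∂ⁱⁿ box 3 m` inside `box 3 n` forces `m ≤ n`. [folklore] -/
theorem le_of_mem_innerBoundary_of_mem_box {n m : ℕ} {y : Site 3}
    (hy : y ∈ innerBoundary (zdGraph 3) (box 3 m)) (hyn : y ∈ box 3 n) : m ≤ n := by
  by_contra h
  exact notMem_box_of_mem_innerBoundary (not_le.1 h) hy hyn

/-- **Degenerate aspect.** For `m ≤ n` the blocked event is EMPTY: the corner of `box 3 m` lies in
`box 3 n` and is joined to itself by the empty (open) path, whatever is closed. [folklore] -/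
theorem blockedEv_eq_empty {k n m : ℕ} (h : m ≤ n) : blockedEv k n m = ∅ := by
  ext ω
  simp only [blockedEv, Set.mem_setOf_eq, Set.mem_empty_iff_false, iff_false, not_exists, not_and]
  intro S _ hall
  have hxn : (fun _ => (m : ℤ)) ∈ box 3 n := by
    simp only [mem_box]
    intro i
    constructor <;> omega
  have hm : (fun _ => (m : ℤ)) ∈ (↑(box 3 m) : Set (Site 3)) := by
    simp [mem_box]
  exact hall _ hxn _ (corner_mem_innerBoundary m) ⟨hm, hm, SimpleGraph.Reachable.refl _⟩

/-- `blockProb k n m = 0` for `m ≤ n`. [folklore] -/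
theorem blockProb_eq_zero {k n m : ℕ} (h : m ≤ n) : blockProb k n m = 0 := by
  simp [blockProb, blockedEv_eq_empty h]

/-- The edges of `ℤ³` touching `box 3 n` form an edge cutset, inside `box 3 m`, between `box 3 n` and
`∂ⁱⁿ box 3 m` (`n < m`): the first edge of any crossing walk touches `box 3 n`. [folklore] -/
theorem isEdgeCutsetIn_edgesTouching {n m : ℕ} (h : n < m) :
    IsEdgeCutsetIn (zdGraph 3) ↑(box 3 m) ↑(box 3 n) ↑(innerBoundary (zdGraph 3) (box 3 m))
      ↑(edgesTouching (zdGraph 3) (box 3 n)) := by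
  intro a b ha hb p
  cases p with
  | nil => exact absurd ha (notMem_box_of_mem_innerBoundary h hb)
  | cons hadj q =>
    rename_i c
    refine ⟨s(a, c), by simp, ?_⟩
    rw [Sym2.map_mk, Finset.mem_coe, mem_edgesTouching_iff]
    exact ⟨(SimpleGraph.induce_adj.1 hadj), a, ha, Sym2.mem_mk_left _ _⟩

/-- `edgesTouching` consists of lattice edges. [folklore] -/
theorem coe_edgesTouching_subset (n : ℕ) :
    (↑(edgesTouching (zdGraph 3) (box 3 n)) : Set (Sym2 (Site 3))) ⊆ (zdGraph 3).edgeSet := by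
  intro e he
  rw [Finset.mem_coe, mem_edgesTouching_iff] at he
  exact he.1

/-- If every lattice edge touching `box 3 n` is closed and `ω` is a lattice configuration, the annulus
`box 3 n → ∂ⁱⁿ box 3 m` (`n < m`) is blocked at budget `0` (hence at every budget). [folklore] -/
theorem mem_blockedEv_of_disjoint {k n m : ℕ} (h : n < m) {ω : BondConfig (Site 3)}
    (hω : ω ⊆ (zdGraph 3).edgeSet) (hF : Disjoint (↑(edgesTouching (zdGraph 3) (box 3 n))) ω) :
    ω ∈ blockedEv k n m := by
  have hcut := (isEdgeCutsetIn_edgesTouching h).isOpenCutsetIn_inter hω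
  rw [Set.disjoint_iff_inter_eq_empty.1 hF, isOpenCutsetIn_iff_not_exists] at hcut
  refine ⟨∅, by simp, ?_⟩
  simpa using hcut

/-- `P_{p_c}` is carried by lattice configurations. [folklore] -/
theorem ae_subset : ∀ᵐ ω ∂μc, ω ⊆ (zdGraph 3).edgeSet :=
  ProbabilityTheory.setBernoulli_ae_subset

/-- Monotonicity of `μc.real` along an a.e. inclusion valid on lattice configurations. [folklore] -/
theorem real_mono_of_lattice {A B : Set (BondConfig (Site 3))}
    (h : ∀ ω, ω ⊆ (zdGraph 3).edgeSet → ω ∈ A → ω ∈ B) : μc.real A ≤ μc.real B := by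
  have hle : A ≤ᵐ[μc] B := by
    filter_upwards [ae_subset] with ω hω hA using h ω hω hA
  simp only [measureReal_def]
  exact ENNReal.toReal_mono (measure_ne_top _ _) (measure_mono_ae hle)

/-- `p_c(ℤ³) < 1` (Grimmett 1999 Thm (1.10), proved in tree). [folklore] -/
theorem pc_lt_one : ((criticalProbI 3 : unitInterval) : ℝ) < 1 := by
  rw [coe_criticalProbI]
  exact criticalProb_zd_lt_one (by norm_num)

/-- **Finite energy / positivity.** For `n < m` every budget-`k` blocked event has probability at least
`(1 - p_c)^{#edges touching box 3 n} > 0`.  Consequence: on any FINITE set of `n` the uniform constant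
`c'` of the crux is automatic — only the asymptotics in `n` carry content. [folklore] -/
theorem blockProb_ge_pow {k n m : ℕ} (h : n < m) :
    (1 - (criticalProbI 3 : ℝ)) ^ (edgesTouching (zdGraph 3) (box 3 n)).card ≤ blockProb k n m := by
  rw [← bondPercolation_real_setOf_disjoint (zdGraph 3) (criticalProbI 3) _ (coe_edgesTouching_subset n)]
  exact real_mono_of_lattice fun ω hω hd => mem_blockedEv_of_disjoint h hω hd

/-- `0 < blockProb k n m` for `n < m`. [folklore] -/
theorem blockProb_pos {k n m : ℕ} (h : n < m) : 0 < blockProb k n m :=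
  lt_of_lt_of_le (pow_pos (sub_pos.2 pc_lt_one) _) (blockProb_ge_pow h)

/-- `blockProb ≤ 1`. [folklore] -/
theorem blockProb_le_one (k n m : ℕ) : blockProb k n m ≤ 1 :=
  measureReal_le_one

/-- `0 ≤ blockProb`. [folklore] -/
theorem blockProb_nonneg (k n m : ℕ) : 0 ≤ blockProb k n m :=
  measureReal_nonneg

/-- Budget monotonicity: more closures allowed, larger event. [folklore] -/
theorem blockedEv_mono_budget {k k' : ℕ} (h : k ≤ k') (n m : ℕ) : blockedEv k n m ⊆ blockedEv k' n m := by
  rintro ω ⟨S, hS, hb⟩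
  exact ⟨S, hS.trans h, hb⟩

/-- `blockProb` is monotone in the budget. [folklore] -/
theorem blockProb_mono_budget {k k' : ℕ} (h : k ≤ k') (n m : ℕ) : blockProb k n m ≤ blockProb k' n m :=
  measureReal_mono (blockedEv_mono_budget h n m)

/-- **First-exit lemma for the annulus.** On a lattice configuration, an open crossing inside `box 3 M'`
from `x ∈ box 3 M` to `∂ⁱⁿ box 3 M'` (`M ≤ M'`) has an initial segment inside `box 3 M` from `x` to
`∂ⁱⁿ box 3 M`. [folklore] -/
theorem exists_crossing_of_crossing {M M' : ℕ} (hM : M ≤ M') {ω : BondConfig (Site 3)}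
    (hω : ω ⊆ (zdGraph 3).edgeSet) {x y : Site 3} (hx : x ∈ box 3 M)
    (hy : y ∈ innerBoundary (zdGraph 3) (box 3 M'))
    (hxy : ω ∈ openConnIn (↑(box 3 M') : Set (Site 3)) x y) :
    ∃ z ∈ innerBoundary (zdGraph 3) (box 3 M), ω ∈ openConnIn (↑(box 3 M) : Set (Site 3)) x z := by
  obtain ⟨hxS, hyS, hr⟩ := hxy
  by_cases hyM : y ∈ box 3 M
  · have hMM : M' ≤ M := le_of_mem_innerBoundary_of_mem_box hy hyM
    obtain rfl : M = M' := le_antisymm hM hMM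
    exact ⟨y, hy, hxS, hyS, hr⟩
  · have hle : openGraph ω ≤ zdGraph 3 := fun a b hab => hω ((openGraph_adj _ _ _).1 hab).1
    have hr' : (openGraph ω).Reachable x y :=
      hr.map (SimpleGraph.Embedding.induce (↑(box 3 M') : Set (Site 3))).toHom
    obtain ⟨w⟩ := hr'
    obtain ⟨z, hz, hxM, hzM, hreach⟩ := exists_innerBoundary_reachable_of_walk hle (box 3 M) w hx hyM
    exact ⟨z, hz, hxM, hzM, hreach⟩

/-- **Aspect monotonicity (a.s.).** On lattice configurations, blocking the annulus `box n → ∂ box M`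
blocks every longer annulus `box n → ∂ box M'`, `n ≤ M ≤ M'`, with the same closed set. [folklore] -/
theorem blockedEv_mono_aspect {k n M M' : ℕ} (hnM : n ≤ M) (hM : M ≤ M') {ω : BondConfig (Site 3)}
    (hω : ω ⊆ (zdGraph 3).edgeSet) (h : ω ∈ blockedEv k n M) : ω ∈ blockedEv k n M' := by
  obtain ⟨S, hS, hb⟩ := h
  refine ⟨S, hS, ?_⟩
  rintro ⟨x, hx, y, hy, hxy⟩
  have hω' : ω \ ↑S ⊆ (zdGraph 3).edgeSet := Set.sdiff_subset.trans hω
  obtain ⟨z, hz, hxz⟩ := exists_crossing_of_crossing hM hω' (box_mono 3 hnM hx) hy hxy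
  exact hb ⟨x, hx, z, hz, hxz⟩

/-- `blockProb k n M ≤ blockProb k n M'` for `n ≤ M ≤ M'`. [folklore] -/
theorem blockProb_mono_aspect {k n M M' : ℕ} (hnM : n ≤ M) (hM : M ≤ M') :
    blockProb k n M ≤ blockProb k n M' :=
  real_mono_of_lattice fun _ hω h => blockedEv_mono_aspect hnM hM hω h

/-- A positive lower bound on finitely many positive reals indexed by `1 ≤ n < N`. [folklore] -/
theorem exists_pos_lower_bound (f : ℕ → ℝ) (hf : ∀ n, 1 ≤ n → 0 < f n) (N : ℕ) :
    ∃ c' : ℝ, 0 < c' ∧ ∀ n, 1 ≤ n → n < N → c' ≤ f n := by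
  induction N with
  | zero => exact ⟨1, one_pos, fun n _ h => absurd h (Nat.not_lt_zero n)⟩
  | succ N ih =>
    obtain ⟨c', hc', hN⟩ := ih
    rcases Nat.eq_zero_or_pos N with rfl | hNpos
    · exact ⟨1, one_pos, fun n h1 h2 => by omega⟩
    · refine ⟨min c' (f N), lt_min hc' (hf N hNpos), fun n h1 h2 => ?_⟩
      rcases Nat.lt_succ_iff_lt_or_eq.1 h2 with hlt | rfl
      · exact (min_le_left _ _).trans (hN n h1 hlt)
      · exact min_le_right _ _

/-! ## §1b The trivial rung: one budget unit costs a factor `#edgesIn(box m) / (1 - p_c)`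

The BASELINE every proof of the crux must improve on: by locality a blocking set may be taken among the
lattice edges inside the box, the last closed edge can be charged to finite energy (deletion tolerance,
`(1-p) · P(ω \ {e} ∈ A) ≤ P(A)` for the measurable budget event `A`, which does not read `ω(e)` after the
deletion), and a union bound over its position costs `#edgesIn(box m)`.  Hence PinholeClosing holds with the
NON-uniform constant `c'(n) = c (1 - p_c) / (1 - p_c + #edgesIn(box 3 (l n))) ≍ c · n⁻³`
(`pinholeClosing_baseline`); the crux is exactly the removal of this entropy factor. -/

/-- The blocked event is the min-cut event `{MinCut ≤ k}` of `MinOpenCut.lean`. [folklore] -/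
theorem blockedEv_eq_setOf_minCut (k n m : ℕ) :
    blockedEv k n m = {ω | minOpenCutIn (↑(box 3 m) : Set (Site 3)) ↑(box 3 n)
      ↑(innerBoundary (zdGraph 3) (box 3 m)) ω ≤ k} := by
  ext ω
  simp only [blockedEv, Set.mem_setOf_eq, minOpenCutIn_le_iff, Finset.mem_coe]

/-- The budget events are measurable (cylinder events of the finite box). [folklore] -/
theorem measurableSet_blockedEv (k n m : ℕ) : MeasurableSet (blockedEv k n m) := by
  rw [blockedEv_eq_setOf_minCut]
  exact measurableSet_setOf_minOpenCutIn_le (Finset.finite_toSet _) _ _ k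

/-- Restricting a closed set to the lattice edges inside the box does not change the configuration seen
inside the box (lattice configurations). [folklore] -/
theorem sdiff_filter_edgesIn_eq {m : ℕ} {ω : BondConfig (Site 3)} (hω : ω ⊆ (zdGraph 3).edgeSet)
    (S : Finset (Sym2 (Site 3))) :
    ω \ ↑(S.filter fun e => e ∈ edgesIn (zdGraph 3) (box 3 m)) =
      ω \ (↑S ∩ (↑(box 3 m) : Set (Site 3)).sym2) := by
  ext e
  induction e using Sym2.ind with
  | h a b =>
    simp only [Set.mem_sdiff, Finset.coe_filter, Set.mem_setOf_eq, mem_edgesIn_iff, Set.mem_inter_iff,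
      Finset.mem_coe, Set.mk_mem_sym2_iff, Sym2.mem_iff, forall_eq_or_imp, forall_eq]
    constructor
    · rintro ⟨heω, hne⟩
      exact ⟨heω, fun ⟨heS, ha, hb⟩ => hne ⟨heS, hω heω, ha, hb⟩⟩
    · rintro ⟨heω, hne⟩
      exact ⟨heω, fun ⟨heS, _, ha, hb⟩ => hne ⟨heS, ha, hb⟩⟩

/-- **Normal form of a blocking set** (lattice configurations): it may be taken among the lattice edges
inside `box 3 m`. [folklore] -/
theorem exists_cutset_subset_edgesIn {k n m : ℕ} {ω : BondConfig (Site 3)}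
    (hω : ω ⊆ (zdGraph 3).edgeSet) (h : ω ∈ blockedEv k n m) :
    ∃ S : Finset (Sym2 (Site 3)), S ⊆ edgesIn (zdGraph 3) (box 3 m) ∧ S.card ≤ k ∧
      ¬ ∃ x ∈ box 3 n, ∃ y ∈ innerBoundary (zdGraph 3) (box 3 m),
        (ω \ ↑S) ∈ openConnIn ↑(box 3 m) x y := by
  obtain ⟨S, hS, hb⟩ := h
  refine ⟨S.filter fun e => e ∈ edgesIn (zdGraph 3) (box 3 m), fun e he => (Finset.mem_filter.1 he).2,
    (Finset.card_filter_le _ _).trans hS, ?_⟩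
  rw [sdiff_filter_edgesIn_eq hω]
  have hb' : IsOpenCutsetIn (↑(box 3 m) : Set (Site 3)) ↑(box 3 n) ↑(innerBoundary (zdGraph 3) (box 3 m))
      ω ↑S := fun x hx y hy hxy => hb ⟨x, hx, y, hy, hxy⟩
  have hb'' := isOpenCutsetIn_inter_sym2_iff.2 hb'
  rintro ⟨x, hx, y, hy, hxy⟩
  exact hb'' x hx y hy hxy

/-- **Union-bound decomposition** (lattice configurations): budget `k+1` = budget `k`, or budget `k` after
closing ONE lattice edge inside the box. [folklore] -/
theorem blockedEv_succ_subset {k n m : ℕ} {ω : BondConfig (Site 3)} (hω : ω ⊆ (zdGraph 3).edgeSet)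
    (h : ω ∈ blockedEv (k + 1) n m) :
    ω ∈ blockedEv k n m ∪ ⋃ e ∈ edgesIn (zdGraph 3) (box 3 m),
      (fun ω' : BondConfig (Site 3) => ω' \ {e}) ⁻¹' blockedEv k n m := by
  obtain ⟨S, hSE, hS, hb⟩ := exists_cutset_subset_edgesIn hω h
  by_cases hk : S.card ≤ k
  · exact Or.inl ⟨S, hk, hb⟩
  · have hpos : 0 < S.card := by omega
    obtain ⟨e, he⟩ := Finset.card_pos.1 hpos
    refine Or.inr (Set.mem_biUnion (hSE he) ?_)
    refine ⟨S.erase e, ?_, ?_⟩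
    · rw [Finset.card_erase_of_mem he]; omega
    · have hset : (ω \ {e}) \ ↑(S.erase e) = ω \ ↑S := by
        ext f
        by_cases hfe : f = e
        · subst hfe
          simp [he]
        · simp [hfe]
      show ¬ ∃ x ∈ box 3 n, ∃ y ∈ innerBoundary (zdGraph 3) (box 3 m),
        ((ω \ {e}) \ ↑(S.erase e)) ∈ openConnIn ↑(box 3 m) x y
      rw [hset]
      exact hb

/-- **Deletion tolerance for the budget event**: `(1 - p_c) · P(ω \ {e} ∈ bEv k) ≤ P(bEv k)`. [folklore] -/
theorem real_preimage_sdiff_singleton_le (k n m : ℕ) (e : Sym2 (Site 3)) :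
    (1 - (criticalProbI 3 : ℝ)) * μc.real ((fun ω : BondConfig (Site 3) => ω \ {e}) ⁻¹' blockedEv k n m)
      ≤ blockProb k n m := by
  have h := bondPercolation_pow_mul_real_preimage_closeEdges_le (zdGraph 3) (criticalProbI 3) {e}
    (measurableSet_blockedEv k n m)
  simpa [closeEdges_eq, blockProb] using h

/-- **One rung costs a factor `1 + #edgesIn(box m)/(1 - p_c)`**:
`P(MinCut ≤ k+1) ≤ (1 + #edgesIn(box 3 m) / (1 - p_c)) · P(MinCut ≤ k)`. [folklore] -/
theorem blockProb_succ_le (k n m : ℕ) :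
    blockProb (k + 1) n m ≤
      (1 + ((edgesIn (zdGraph 3) (box 3 m)).card : ℝ) / (1 - (criticalProbI 3 : ℝ))) * blockProb k n m := by
  have hq : 0 < 1 - (criticalProbI 3 : ℝ) := sub_pos.2 pc_lt_one
  set T := edgesIn (zdGraph 3) (box 3 m) with hT
  set pre : Sym2 (Site 3) → Set (BondConfig (Site 3)) :=
    fun e => (fun ω : BondConfig (Site 3) => ω \ {e}) ⁻¹' blockedEv k n m with hpre
  have h1 : blockProb (k + 1) n m ≤ μc.real (blockedEv k n m ∪ ⋃ e ∈ T, pre e) :=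
    real_mono_of_lattice fun ω hω h => blockedEv_succ_subset hω h
  have h2 : μc.real (blockedEv k n m ∪ ⋃ e ∈ T, pre e) ≤ blockProb k n m + ∑ e ∈ T, μc.real (pre e) :=
    (measureReal_union_le _ _).trans (by
      unfold blockProb
      gcongr
      exact measureReal_biUnion_finset_le _ _)
  have h3 : ∀ e ∈ T, μc.real (pre e) ≤ blockProb k n m / (1 - (criticalProbI 3 : ℝ)) := by
    intro e _
    rw [le_div_iff₀ hq, mul_comm]
    exact real_preimage_sdiff_singleton_le k n m e
  calc blockProb (k + 1) n m ≤ blockProb k n m + ∑ e ∈ T, μc.real (pre e) := h1.trans h2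
    _ ≤ blockProb k n m + ∑ _e ∈ T, blockProb k n m / (1 - (criticalProbI 3 : ℝ)) := by
        gcongr with e he; exact h3 e he
    _ = (1 + (T.card : ℝ) / (1 - (criticalProbI 3 : ℝ))) * blockProb k n m := by
        rw [Finset.sum_const, nsmul_eq_mul]; ring

/-- **The baseline (non-uniform pinhole closing).**  For every k, l ≥ 1, n:
`P(MinCut(n, 2ln) ≤ k) ≥ (1 - p_c)/(1 - p_c + #edgesIn(box 3 (l n))) · P(MinCut(n, l n) ≤ k+1)` — the crux
with `c'(n) ≍ c · n⁻³` instead of a uniform `c'`. [folklore] -/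
theorem pinholeClosing_baseline (k l n : ℕ) (hl : 1 ≤ l) :
    (1 - (criticalProbI 3 : ℝ)) / (1 - (criticalProbI 3 : ℝ) + (edgesIn (zdGraph 3) (box 3 (l * n))).card) *
        blockProb (k + 1) n (l * n) ≤ blockProb k n (2 * l * n) := by
  have hq : 0 < 1 - (criticalProbI 3 : ℝ) := sub_pos.2 pc_lt_one
  set E : ℝ := ((edgesIn (zdGraph 3) (box 3 (l * n))).card : ℝ) with hE
  have hE0 : 0 ≤ E := by positivity
  have h1 := blockProb_succ_le k n (l * n)
  have h2 : blockProb k n (l * n) ≤ blockProb k n (2 * l * n) :=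
    blockProb_mono_aspect (by nlinarith) (by nlinarith)
  have hden : 0 < 1 - (criticalProbI 3 : ℝ) + E := by linarith
  rw [div_mul_eq_mul_div, div_le_iff₀ hden]
  have h1' : blockProb (k + 1) n (l * n) * (1 - (criticalProbI 3 : ℝ)) ≤
      (1 - (criticalProbI 3 : ℝ) + E) * blockProb k n (l * n) := by
    have := mul_le_mul_of_nonneg_right h1 hq.le
    calc blockProb (k + 1) n (l * n) * (1 - (criticalProbI 3 : ℝ))
        ≤ (1 + E / (1 - (criticalProbI 3 : ℝ))) * blockProb k n (l * n) * (1 - (criticalProbI 3 : ℝ)) := this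
      _ = (1 - (criticalProbI 3 : ℝ) + E) * blockProb k n (l * n) := by
          field_simp
  calc (1 - (criticalProbI 3 : ℝ)) * blockProb (k + 1) n (l * n)
      = blockProb (k + 1) n (l * n) * (1 - (criticalProbI 3 : ℝ)) := by ring
    _ ≤ (1 - (criticalProbI 3 : ℝ) + E) * blockProb k n (l * n) := h1'
    _ ≤ (1 - (criticalProbI 3 : ℝ) + E) * blockProb k n (2 * l * n) := by gcongr
    _ = blockProb k n (2 * l * n) * (1 - (criticalProbI 3 : ℝ) + E) := by ring

/-! ## §2 Load-bearing analysis -/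

/-- The crux with the guard `2 ≤ l` DROPPED. [folklore] -/
def PinholeClosingWithoutL : Prop :=
  ∀ (k l : ℕ) (c : ℝ), 0 < c → ∃ c' : ℝ, 0 < c' ∧ ∀ n : ℕ, 1 ≤ n →
    c ≤ blockProb (k + 1) n (l * n) → c' ≤ blockProb k n (2 * l * n)

/-- **`2 ≤ l` is not load-bearing**: for `l ≤ 1` the premise event is empty (`blockProb_eq_zero`), so the
new instances are vacuous and the guard-free statement is EQUIVALENT to the crux. [folklore] -/
theorem pinholeClosingWithoutL_iff : PinholeClosingWithoutL ↔ PercBudgetLadder.PinholeClosing := by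
  rw [pinholeClosing_iff]
  constructor
  · exact fun h k l c _ hc => h k l c hc
  · intro h k l c hc
    by_cases hl : 2 ≤ l
    · exact h k l c hl hc
    · refine ⟨1, one_pos, fun n hn hprem => ?_⟩
      have : blockProb (k + 1) n (l * n) = 0 := blockProb_eq_zero (by nlinarith)
      linarith

/-- The crux with the guard `1 ≤ n` DROPPED. [folklore] -/
def PinholeClosingWithoutN : Prop :=
  ∀ (k l : ℕ) (c : ℝ), 2 ≤ l → 0 < c → ∃ c' : ℝ, 0 < c' ∧ ∀ n : ℕ,
    c ≤ blockProb (k + 1) n (l * n) → c' ≤ blockProb k n (2 * l * n)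

/-- **`1 ≤ n` is not load-bearing**: at `n = 0` both boxes are `{0}` and the premise event is empty.
[folklore] -/
theorem pinholeClosingWithoutN_iff : PinholeClosingWithoutN ↔ PercBudgetLadder.PinholeClosing := by
  rw [pinholeClosing_iff]
  constructor
  · exact fun h k l c hl hc => let ⟨c', hc', hn⟩ := h k l c hl hc; ⟨c', hc', fun n _ => hn n⟩
  · intro h k l c hl hc
    obtain ⟨c', hc', hn⟩ := h k l c hl hc
    refine ⟨c', hc', fun n hprem => ?_⟩
    rcases Nat.eq_zero_or_pos n with rfl | hnpos
    · have : blockProb (k + 1) 0 (l * 0) = 0 := blockProb_eq_zero (by simp)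
      linarith
    · exact hn n hnpos hprem

/-- The crux with the positivity `0 < c'` of the conclusion DROPPED. [folklore] -/
def PinholeClosingWithoutCpos : Prop :=
  ∀ (k l : ℕ) (c : ℝ), 2 ≤ l → 0 < c → ∃ c' : ℝ, ∀ n : ℕ, 1 ≤ n →
    c ≤ blockProb (k + 1) n (l * n) → c' ≤ blockProb k n (2 * l * n)

/-- **`0 < c'` is the entire content**: without it `c' = 0` works. [folklore] -/
theorem pinholeClosingWithoutCpos_trivial : PinholeClosingWithoutCpos :=
  fun k l _ _ _ => ⟨0, fun n _ _ => blockProb_nonneg k n (2 * l * n)⟩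

/-- The crux with the positivity `0 < c` of the premise constant DROPPED. [folklore] -/
def PinholeClosingWithoutC : Prop :=
  ∀ (k l : ℕ) (c : ℝ), 2 ≤ l → ∃ c' : ℝ, 0 < c' ∧ ∀ n : ℕ, 1 ≤ n →
    c ≤ blockProb (k + 1) n (l * n) → c' ≤ blockProb k n (2 * l * n)

/-- Uniform budget-`k` blocking at every aspect `2l ≥ 4`: the statement the crux becomes without its
premise.  At `k = 0` this is a uniform RSW lower bound, stronger than the route target X. [folklore] -/
def UniformBudgetBlocking : Prop :=
  ∀ (k l : ℕ), 2 ≤ l → ∃ c' : ℝ, 0 < c' ∧ ∀ n : ℕ, 1 ≤ n → c' ≤ blockProb k n (2 * l * n)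

/-- **`0 < c` (equivalently: the premise) is load-bearing in the upward direction**: dropping it turns the
crux into `UniformBudgetBlocking` (take `c = 0`, whose premise is trivially true), i.e. into an
unconditional uniform RSW-type statement that already implies the route target without r2.  So the premise is
exactly what keeps r3 strictly below the target; it cannot be weakened away. [folklore] -/
theorem pinholeClosingWithoutC_iff : PinholeClosingWithoutC ↔ UniformBudgetBlocking := by
  constructor
  · intro h k l hl
    obtain ⟨c', hc', hstep⟩ := h k l 0 hl
    exact ⟨c', hc', fun n hn => hstep n hn (blockProb_nonneg _ _ _)⟩
  · intro h k l c hl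
    obtain ⟨c', hc', hstep⟩ := h k l hl
    exact ⟨c', hc', fun n hn _ => hstep n hn⟩

/-- `UniformBudgetBlocking` implies the route target `CritAnnulusBlockedIO` outright (k = 0, aspect 4).
[folklore] -/
theorem critAnnulusBlockedIO_of_uniform (h : UniformBudgetBlocking) :
    PercBudgetLadder.CritAnnulusBlockedIO := by
  obtain ⟨c', hc', hn⟩ := h 0 2 le_rfl
  refine ⟨4, c', by norm_num, hc', fun N => ⟨N + 1, by omega, ?_⟩⟩
  have h4 := hn (N + 1) (by omega)
  have hset : blockedEv 0 (N + 1) (2 * 2 * (N + 1)) =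
      {ω | ¬ ∃ x ∈ box 3 (N + 1), ∃ y ∈ innerBoundary (zdGraph 3) (box 3 (4 * (N + 1))),
        ω ∈ openConnIn ↑(box 3 (4 * (N + 1))) x y} := by
    ext ω
    simp only [blockedEv, Set.mem_setOf_eq, Nat.le_zero, Finset.card_eq_zero, exists_eq_left,
      Finset.coe_empty, Set.sdiff_empty]
  have : blockProb 0 (N + 1) (2 * 2 * (N + 1)) = μc.real {ω | ¬ ∃ x ∈ box 3 (N + 1),
      ∃ y ∈ innerBoundary (zdGraph 3) (box 3 (4 * (N + 1))), ω ∈ openConnIn ↑(box 3 (4 * (N + 1))) x y} := by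
    rw [blockProb, hset]
  rw [this] at h4
  exact h4

/-! ## §3 Why it resists: ¬r2 → r3 and X_B → r3 -/

/-- **¬BudgetTightness → PinholeClosing.**  If the critical budgets are NOT tight (crux r2 false: for all
k, l, c the budget-k blocking probability at aspect l is eventually < c), then the premise of r3 at
(k+1, l, c) holds for only finitely many n, on which `c'` = a finite minimum of the positive numbers
`blockProb k n (2ln)` (`blockProb_pos`) works.  So r3 can fail only in a world where r2 HOLDS.
[folklore] -/
theorem pinholeClosing_of_not_budgetTightness (hBT : ¬ PercBudgetLadder.BudgetTightness) :
    PercBudgetLadder.PinholeClosing := by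
  rw [pinholeClosing_iff]
  rw [budgetTightness_iff] at hBT
  push Not at hBT
  intro k l c hl hc
  obtain ⟨N, hN⟩ := hBT (k + 1) l c hl hc
  obtain ⟨c', hc', hmin⟩ := exists_pos_lower_bound (fun n => blockProb k n (2 * l * n))
    (fun n hn => blockProb_pos (by nlinarith)) N
  refine ⟨c', hc', fun n hn hprem => hmin n hn ?_⟩
  by_contra hnN
  exact absurd hprem (not_le.2 (hN n (not_lt.1 hnN)))

/-- Contrapositive: **a refutation of r3 is a proof of r2.** [folklore] -/
theorem budgetTightness_of_not_pinholeClosing (h : ¬ PercBudgetLadder.PinholeClosing) :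
    PercBudgetLadder.BudgetTightness := by
  by_contra hBT
  exact h (pinholeClosing_of_not_budgetTightness hBT)

/-- The two load-bearing cruxes of the route are jointly EXHAUSTIVE: `r2 ∨ r3` is a theorem. [folklore] -/
theorem budgetTightness_or_pinholeClosing :
    PercBudgetLadder.BudgetTightness ∨ PercBudgetLadder.PinholeClosing := by
  by_cases h : PercBudgetLadder.BudgetTightness
  · exact Or.inl h
  · exact Or.inr (pinholeClosing_of_not_budgetTightness h)

/-- `P(¬A) ≥ 1 - P(A)` for the outer measure (no measurability needed). [folklore] -/
theorem one_sub_le_real_compl (A : Set (BondConfig (Site 3))) : 1 - μc.real A ≤ μc.real Aᶜ := by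
  have h1 : μc.real Set.univ ≤ μc.real A + μc.real Aᶜ := by
    rw [← Set.union_compl_self A]; exact measureReal_union_le _ _
  have hu : μc.real Set.univ = 1 := by simp
  linarith

/-- Budget `0` is the plain blocked event (the only `S` with `#S ≤ 0` is `∅`). [folklore] -/
theorem blockedEv_zero (n m : ℕ) :
    blockedEv 0 n m = {ω | ∃ x ∈ box 3 n, ∃ y ∈ innerBoundary (zdGraph 3) (box 3 m),
      ω ∈ openConnIn ↑(box 3 m) x y}ᶜ := by
  ext ω
  simp only [blockedEv, Set.mem_setOf_eq, Nat.le_zero, Finset.card_eq_zero, exists_eq_left,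
    Finset.coe_empty, Set.sdiff_empty, Set.mem_compl_iff]

/-- **X_B → PinholeClosing.**  The uniform critical-annulus RSW bound of route PercAnnulusCrossing
(`CritAnnulusNonCrossing`: P_{p_c}(box n ↔ ∂ box 2n in box 2n) ≤ 1 - c₀ for all n ≥ 1) gives the conclusion of
r3 with `c' = c₀` for every k, l ≥ 1 and n, premise or not: budget 0 ≤ budget k and aspect 2 ≤ aspect 2l
(`blockProb_mono_aspect`, a.s. first-exit decomposition).  So r3 is WEAKER than the standing RSW crux X_B.
[folklore] -/
theorem pinholeClosing_of_critAnnulusNonCrossing (hX : PercAnnulusCrossing.CritAnnulusNonCrossing) :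
    PercBudgetLadder.PinholeClosing := by
  rw [pinholeClosing_iff]
  obtain ⟨c₀, hc₀, hRSW⟩ := hX
  intro k l c hl _
  refine ⟨c₀, hc₀, fun n hn _ => ?_⟩
  calc c₀ ≤ 1 - μc.real {ω | ∃ x ∈ box 3 n, ∃ y ∈ innerBoundary (zdGraph 3) (box 3 (2 * n)),
            ω ∈ openConnIn ↑(box 3 (2 * n)) x y} := by linarith [hRSW n hn]
    _ ≤ blockProb 0 n (2 * n) := by
        rw [blockProb, blockedEv_zero]; exact one_sub_le_real_compl _
    _ ≤ blockProb 0 n (2 * l * n) := blockProb_mono_aspect (by omega) (by nlinarith)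
    _ ≤ blockProb k n (2 * l * n) := blockProb_mono_budget (Nat.zero_le k) _ _

/-- **Any uniform blocking bound at an aspect `λ₀ ≤ 4` gives the crux** (with `c' =` that bound, premise
unused): the conclusion's aspect `2l ≥ 4 ≥ λ₀` is only easier to block.  Covers X_B (`λ₀ = 2`) and every
RSW-type crux on the books stated at aspects 2, 3 or 4. [folklore] -/
theorem pinholeClosing_of_uniform_blocking {l₀ : ℕ} (h1 : 1 ≤ l₀) (h4 : l₀ ≤ 4)
    (h : ∃ c : ℝ, 0 < c ∧ ∀ n : ℕ, 1 ≤ n → c ≤ blockProb 0 n (l₀ * n)) :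
    PercBudgetLadder.PinholeClosing := by
  rw [pinholeClosing_iff]
  obtain ⟨c₀, hc₀, hb⟩ := h
  intro k l c hl _
  refine ⟨c₀, hc₀, fun n hn _ => ?_⟩
  calc c₀ ≤ blockProb 0 n (l₀ * n) := hb n hn
    _ ≤ blockProb 0 n (2 * l * n) := blockProb_mono_aspect (by nlinarith) (by nlinarith)
    _ ≤ blockProb k n (2 * l * n) := blockProb_mono_budget (Nat.zero_le k) _ _

/-- **Resistance certificate.**  ¬r3 → (r2 ∧ ¬X_B): any refutation of PinholeClosing simultaneously PROVES
bounded-budget tightness at p_c(ℤ³) (open; the d<6 side of hyperscaling) and REFUTES the uniform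
critical-annulus RSW bound X_B of route PercAnnulusCrossing (open).  No cheap attack (finite computation,
degenerate instance, catalogued barrier) can produce either. [folklore] -/
theorem not_pinholeClosing_imp (h : ¬ PercBudgetLadder.PinholeClosing) :
    PercBudgetLadder.BudgetTightness ∧ ¬ PercAnnulusCrossing.CritAnnulusNonCrossing :=
  ⟨budgetTightness_of_not_pinholeClosing h, fun hX => h (pinholeClosing_of_critAnnulusNonCrossing hX)⟩

/-- **Kill criterion, made precise.**  r3 fails iff for some k, l ≥ 2, c > 0 there are qualifying n
(premise ≥ c) with ARBITRARILY SMALL budget-k blocking at aspect 2l; by `blockProb_pos` such n are then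
necessarily UNBOUNDED (for every N and ε some qualifying n ≥ N has blockProb k n (2ln) < ε).  A refuting
witness is therefore an asymptotic statement about P_{p_c(ℤ³)} along a subsequence — out of reach of `decide`,
small models or extreme-parameter instances. [folklore] -/
theorem kill_criterion (h : ¬ PercBudgetLadder.PinholeClosing) :
    ∃ (k l : ℕ) (c : ℝ), 2 ≤ l ∧ 0 < c ∧ ∀ (N : ℕ) (ε : ℝ), 0 < ε →
      ∃ n : ℕ, N ≤ n ∧ c ≤ blockProb (k + 1) n (l * n) ∧ blockProb k n (2 * l * n) < ε := by
  rw [pinholeClosing_iff] at h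
  push Not at h
  obtain ⟨k, l, c, hl, hc, hbad⟩ := h
  refine ⟨k, l, c, hl, hc, fun N ε hε => ?_⟩
  obtain ⟨c₁, hc₁, hmin⟩ := exists_pos_lower_bound (fun n => blockProb k n (2 * l * n))
    (fun n hn => blockProb_pos (by nlinarith)) N
  obtain ⟨n, hn, hprem, hlt⟩ := hbad (min c₁ ε) (lt_min hc₁ hε)
  refine ⟨n, ?_, hprem, lt_of_lt_of_le hlt (min_le_right _ _)⟩
  by_contra hnN
  have := hmin n hn (not_le.1 hnN)
  exact absurd (lt_of_lt_of_le hlt (min_le_left _ _)) (not_lt.2 this)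

/-! ## §4 The crux is stronger than the Assembly needs -/

/-- The i.o. → i.o. form of pinhole closing: an i.o. lower bound at budget k+1 and aspect l gives an i.o.
lower bound at budget k and aspect 2l.  Implied by the crux; sufficient for the descent. [folklore] -/
def PinholeClosingIO : Prop :=
  ∀ (k l : ℕ) (c : ℝ), 2 ≤ l → 0 < c →
    (∀ N : ℕ, ∃ n : ℕ, N ≤ n ∧ c ≤ blockProb (k + 1) n (l * n)) →
    ∃ c' : ℝ, 0 < c' ∧ ∀ N : ℕ, ∃ n : ℕ, N ≤ n ∧ c' ≤ blockProb k n (2 * l * n)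

/-- The crux implies its i.o. form. [folklore] -/
theorem pinholeClosingIO_of_pinholeClosing (h : PercBudgetLadder.PinholeClosing) : PinholeClosingIO := by
  rw [pinholeClosing_iff] at h
  intro k l c hl hc hio
  obtain ⟨c', hc', hstep⟩ := h k l c hl hc
  refine ⟨c', hc', fun N => ?_⟩
  obtain ⟨n, hn, hb⟩ := hio (N + 1)
  exact ⟨n, by omega, hstep n (by omega) hb⟩

/-- **The route closes from r2 + the i.o. form of r3** (same descent as the planner's `closes`, one
quantifier weaker in r3): planners may weaken the crux to `PinholeClosingIO` at no cost. [folklore] -/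
theorem closes_of_io (hBT : PercBudgetLadder.BudgetTightness) (hPC : PinholeClosingIO)
    (hBV : PercBudgetLadder.BlockingVanishesOfTheta) : _root_.PercolationContinuityZ3 := by
  -- descent
  have descent : ∀ k : ℕ, ∀ (l : ℕ) (c : ℝ), 2 ≤ l → 0 < c →
      (∀ N : ℕ, ∃ n : ℕ, N ≤ n ∧ c ≤ blockProb k n (l * n)) →
      ∃ (l' : ℕ) (c' : ℝ), 2 ≤ l' ∧ 0 < c' ∧ ∀ N : ℕ, ∃ n : ℕ, N ≤ n ∧ c' ≤ blockProb 0 n (l' * n) := by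
    intro k
    induction k with
    | zero => exact fun l c hl hc h => ⟨l, c, hl, hc, h⟩
    | succ k ih =>
      intro l c hl hc h
      obtain ⟨c', hc', hio⟩ := hPC k l c hl hc h
      exact ih (2 * l) c' (by omega) hc' hio
  rw [budgetTightness_iff] at hBT
  obtain ⟨k, l, c, hl, hc, hio⟩ := hBT
  obtain ⟨l', c', hl', hc', hio'⟩ := descent k l c hl hc hio
  by_contra hne
  have h0 : 0 ≤ theta (zdGraph 3) 0 (criticalProbI 3) := measureReal_nonneg
  have hpos : 0 < theta (zdGraph 3) 0 (criticalProbI 3) := lt_of_le_of_ne h0 (fun h => hne h.symm)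
  have hT := hBV (criticalProbI 3) hpos l' hl'
  obtain ⟨N, hN⟩ := Filter.eventually_atTop.mp (hT.eventually (gt_mem_nhds hc'))
  obtain ⟨n, hn, hb⟩ := hio' N
  have hlt := hN n hn
  rw [blockProb, blockedEv_zero] at hb
  exact absurd hlt (not_lt.2 hb)

/-! ## §4b The crux pair is a reformulation of the target, squeezed between aspects 4 and 2^k·l

`X4 ⟹ (r2 ∧ r3_IO) ⟹ X`: the target at aspect ≤ 4 implies BOTH cruxes (r2 with k = 0; r3 in its i.o. form
with c' = the target's constant, premise unused), and the two cruxes give back the target at aspect 2^k l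
(descent).  So, given r2 (needed anyway), the i.o. form of r3 is EQUIVALENT to the target up to the aspect
bookkeeping 4 ↔ 2^k l — the decomposition isolates necessary halves, it does not pass to an easier statement;
whatever makes X hard at aspect 4 is inside r3. -/

/-- The route target restricted to aspects `l ≤ 4` (blocked = budget 0, `blockedEv_zero`). [folklore] -/
def CritAnnulusBlockedIOle4 : Prop :=
  ∃ (l : ℕ) (c : ℝ), 2 ≤ l ∧ l ≤ 4 ∧ 0 < c ∧ ∀ N : ℕ, ∃ n : ℕ, N ≤ n ∧ c ≤ blockProb 0 n (l * n)

/-- `X4 ⟹ r2` (budget 0 is a budget). [folklore] -/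
theorem budgetTightness_of_X4 (h : CritAnnulusBlockedIOle4) : PercBudgetLadder.BudgetTightness := by
  obtain ⟨l, c, hl, -, hc, hio⟩ := h
  rw [budgetTightness_iff]
  exact ⟨0, l, c, hl, hc, hio⟩

/-- `X4 ⟹ r3_IO` (premise unused: aspect `2l ≥ 4 ≥` the target's aspect, budget `k ≥ 0`). [folklore] -/
theorem pinholeClosingIO_of_X4 (h : CritAnnulusBlockedIOle4) : PinholeClosingIO := by
  obtain ⟨l₀, c₀, hl₀, hl₄, hc₀, hio⟩ := h
  intro k l c hl _ _
  refine ⟨c₀, hc₀, fun N => ?_⟩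
  obtain ⟨n, hn, hb⟩ := hio N
  refine ⟨n, hn, hb.trans ?_⟩
  exact (blockProb_mono_aspect (by nlinarith) (by nlinarith)).trans (blockProb_mono_budget (Nat.zero_le k) _ _)

/-- `(r2 ∧ r3_IO) ⟹ X` (the descent half of the planner's `closes`, with the i.o. form of r3). [folklore] -/
theorem critAnnulusBlockedIO_of_cruxes (hBT : PercBudgetLadder.BudgetTightness) (hPC : PinholeClosingIO) :
    PercBudgetLadder.CritAnnulusBlockedIO := by
  have descent : ∀ k : ℕ, ∀ (l : ℕ) (c : ℝ), 2 ≤ l → 0 < c →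
      (∀ N : ℕ, ∃ n : ℕ, N ≤ n ∧ c ≤ blockProb k n (l * n)) →
      ∃ (l' : ℕ) (c' : ℝ), 2 ≤ l' ∧ 0 < c' ∧ ∀ N : ℕ, ∃ n : ℕ, N ≤ n ∧ c' ≤ blockProb 0 n (l' * n) := by
    intro k
    induction k with
    | zero => exact fun l c hl hc h => ⟨l, c, hl, hc, h⟩
    | succ k ih =>
      intro l c hl hc h
      obtain ⟨c', hc', hio⟩ := hPC k l c hl hc h
      exact ih (2 * l) c' (by omega) hc' hio
  rw [budgetTightness_iff] at hBT
  obtain ⟨k, l, c, hl, hc, hio⟩ := hBT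
  obtain ⟨l', c', hl', hc', hio'⟩ := descent k l c hl hc hio
  refine ⟨l', c', hl', hc', fun N => ?_⟩
  obtain ⟨n, hn, hb⟩ := hio' N
  refine ⟨n, hn, ?_⟩
  rw [blockProb, blockedEv_zero] at hb
  exact hb

/-- **Squeeze**: `X4 ⟹ (r2 ∧ r3_IO) ⟹ X`. [folklore] -/
theorem cruxes_squeeze :
    (CritAnnulusBlockedIOle4 → PercBudgetLadder.BudgetTightness ∧ PinholeClosingIO) ∧
    (PercBudgetLadder.BudgetTightness ∧ PinholeClosingIO → PercBudgetLadder.CritAnnulusBlockedIO) :=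
  ⟨fun h => ⟨budgetTightness_of_X4 h, pinholeClosingIO_of_X4 h⟩,
   fun h => critAnnulusBlockedIO_of_cruxes h.1 h.2⟩

/-! ## §5 The pointwise (deterministic) strengthening is FALSE: the single open filament

`PointwisePinholeClosing` — "every CONFIGURATION blockable with k+1 closures at aspect l is blockable with k
closures at aspect 2l" — is the statement one would need for a geometry-only proof.  It fails already at
k = 0, l = 2, n = 1: the configuration `ray` (one open filament along the positive first axis) has budget
exactly 1 at EVERY aspect (close the edge leaving `box 3 n`) and is never blocked at budget 0.  This is the
deterministic caricature of the "jump world" the planner fears (a single filament keeps budgets tight at all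
scales while blocking fails); the content of r3 is that P_{p_c} does not charge such filaments uniformly. -/

/-- The lattice point `(i, 0, 0)`. [folklore] -/
def pt (i : ℕ) : Site 3 := Pi.single 0 (i : ℤ)

@[simp] theorem pt_apply_zero (i : ℕ) : pt i 0 = i := by simp [pt]

theorem pt_apply_ne {j : Fin 3} (hj : j ≠ 0) (i : ℕ) : pt i j = 0 := by simp [pt, hj]

theorem pt_mem_box {i m : ℕ} (h : i ≤ m) : pt i ∈ box 3 m := by
  rw [mem_box]
  intro j
  by_cases hj : j = 0
  · subst hj; simp only [pt_apply_zero]; omega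
  · simp only [pt_apply_ne hj]; omega

theorem le_of_pt_mem_box {i n : ℕ} (h : pt i ∈ box 3 n) : i ≤ n := by
  rw [mem_box] at h
  have := (h 0).2
  simp only [pt_apply_zero] at this
  exact_mod_cast this

theorem pt_injective : Function.Injective pt := by
  intro i j h
  have := congrArg (fun x : Site 3 => x 0) h
  simp only [pt_apply_zero] at this
  exact_mod_cast this

theorem pt_succ_eq (i : ℕ) : pt (i + 1) = pt i + Pi.single 0 1 := by
  simp [pt, Nat.cast_succ, Pi.single_add]

/-- `pt m ∈ ∂ⁱⁿ box 3 m` (its outer neighbour `pt (m+1)` leaves the box). [folklore] -/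
theorem pt_mem_innerBoundary (m : ℕ) : pt m ∈ innerBoundary (zdGraph 3) (box 3 m) := by
  rw [mem_innerBoundary_iff]
  refine ⟨pt_mem_box le_rfl, pt (m + 1), fun h => ?_, ?_⟩
  · have := le_of_pt_mem_box h; omega
  · rw [zdGraph_adj_iff]; exact ⟨0, Or.inl (pt_succ_eq m)⟩

/-- The single open filament `{(i,0,0) ~ (i+1,0,0) : i ∈ ℕ}`. [folklore] -/
def ray : BondConfig (Site 3) := Set.range fun i : ℕ => s(pt i, pt (i + 1))

theorem mem_ray (i : ℕ) : s(pt i, pt (i + 1)) ∈ ray := ⟨i, rfl⟩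

theorem pt_ne_succ (i : ℕ) : pt i ≠ pt (i + 1) := fun h => by
  have := pt_injective h; omega

/-- The filament crosses every annulus: `pt 0 ↔ pt j` inside `box 3 m` for `j ≤ m`. [folklore] -/
theorem ray_reachable (m : ℕ) : ∀ j : ℕ, ∀ hj : j ≤ m,
    ((openGraph ray).induce (↑(box 3 m) : Set (Site 3))).Reachable
      ⟨pt 0, Finset.mem_coe.2 (pt_mem_box (Nat.zero_le m))⟩ ⟨pt j, Finset.mem_coe.2 (pt_mem_box hj)⟩ := by
  intro j
  induction j with
  | zero => intro _; exact SimpleGraph.Reachable.refl _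
  | succ j ih =>
    intro hj
    refine (ih (by omega)).trans (SimpleGraph.Adj.reachable ?_)
    simp only [SimpleGraph.induce_adj, openGraph_adj]
    exact ⟨mem_ray j, pt_ne_succ j⟩

/-- The filament is never blocked at budget `0` (any `n`, `m`). [folklore] -/
theorem ray_notMem_blockedEv_zero (n m : ℕ) : ray ∉ blockedEv 0 n m := by
  rintro ⟨S, hS, hb⟩
  obtain rfl : S = ∅ := Finset.card_eq_zero.1 (Nat.le_zero.1 hS)
  refine hb ⟨pt 0, pt_mem_box (Nat.zero_le n), pt m, pt_mem_innerBoundary m, ?_⟩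
  rw [Finset.coe_empty, Set.sdiff_empty]
  exact ⟨Finset.mem_coe.2 (pt_mem_box (Nat.zero_le m)), Finset.mem_coe.2 (pt_mem_box le_rfl),
    ray_reachable m m le_rfl⟩

/-- After closing the edge leaving `box 3 n`, the open component of `box 3 n` stays inside `box 3 n`.
[folklore] -/
theorem ray_stays {n m : ℕ} (u v : (↑(box 3 m) : Set (Site 3)))
    (huv : ((openGraph (ray \ {s(pt n, pt (n + 1))})).induce (↑(box 3 m) : Set (Site 3))).Reachable u v)
    (hu : (u : Site 3) ∈ box 3 n) : (v : Site 3) ∈ box 3 n := by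
  rw [SimpleGraph.reachable_iff_reflTransGen] at huv
  induction huv with
  | refl => exact hu
  | tail _ hbc ih =>
    rename_i b c
    simp only [SimpleGraph.induce_adj, openGraph_adj, Set.mem_sdiff, Set.mem_singleton_iff] at hbc
    obtain ⟨⟨⟨i, hi⟩, hne⟩, -⟩ := hbc
    have hin : i ≠ n := by rintro rfl; exact hne hi.symm
    rcases Sym2.eq_iff.1 hi with ⟨hb, hc⟩ | ⟨hc, hb⟩
    · -- b = pt i, c = pt (i+1)
      have hi' : i ≤ n := le_of_pt_mem_box (hb ▸ ih)
      rw [← hc]; exact pt_mem_box (by omega)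
    · -- b = pt (i+1), c = pt i
      have hi' : i + 1 ≤ n := le_of_pt_mem_box (hb ▸ ih)
      rw [← hc]; exact pt_mem_box (by omega)

/-- The filament has budget `1` at every aspect: closing `s(pt n, pt (n+1))` blocks `box n → ∂ box m`, `n < m`.
[folklore] -/
theorem ray_mem_blockedEv_one {n m : ℕ} (h : n < m) : ray ∈ blockedEv 1 n m := by
  refine ⟨{s(pt n, pt (n + 1))}, by simp, ?_⟩
  rintro ⟨x, hx, y, hy, hxS, hyS, hr⟩
  rw [Finset.coe_singleton] at hr
  have hyn : y ∈ box 3 n := ray_stays ⟨x, hxS⟩ ⟨y, hyS⟩ hr hx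
  exact notMem_box_of_mem_innerBoundary h hy hyn

/-- The pointwise strengthening of the crux (configuration by configuration). [folklore] -/
def PointwisePinholeClosing : Prop :=
  ∀ (k l : ℕ), 2 ≤ l → ∀ (ω : BondConfig (Site 3)) (n : ℕ), 1 ≤ n →
    ω ∈ blockedEv (k + 1) n (l * n) → ω ∈ blockedEv k n (2 * l * n)

/-- **The pointwise strengthening is false** (witness: the filament `ray`, k = 0, l = 2, n = 1). [folklore] -/
theorem not_pointwisePinholeClosing : ¬ PointwisePinholeClosing := fun h =>
  ray_notMem_blockedEv_zero 1 (2 * 2 * 1) (h 0 2 le_rfl ray 1 le_rfl (ray_mem_blockedEv_one (by norm_num)))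

/-! ## §6 Numerics (evidence, not proof): the joint law of (MinCut(n, l n), MinCut(n, 2 l n)) at p_c

Exact max-flow (= MinCut by Menger; scipy Dinic, unit capacities, `box 3 n` contracted to the source,
`∂ⁱⁿ box 3 m` to the sink, only edges inside `box 3 m`; both cuts from the SAME sample, so `mc2 ≤ mc1`
pathwise — checked by assertion) at p = 0.2488126, script `kitjob/main.py` of this seat.  Full run = kit job
j008606 (seed 20260816, node cmp-8, ≈ 200 s; `compute-j008606.json` attached to the item); smoke = j008096.
mc1 = MinCut(box n → ∂ box (l n)), mc2 = MinCut(box n → ∂ box (2 l n)).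

  n  l   m1  m2  samples | E mc1 (sd)   | E mc2 (sd)  | P(mc1≤j) j=0,1,2,3      | P(mc2≤j) j=0,1,2,3      | P(mc2≤k | mc1≤k+1) k=0,1,2
  1  2    2    4   4000  | 13.33 (3.15) | 4.84 (2.02) | 0.000 0.000 0.000 0.000 | 0.004 0.033 0.117 0.272 |   -     -     -
  2  2    4    8   3000  | 18.66 (3.86) | 5.45 (2.20) | 0.000 0.000 0.000 0.000 | 0.002 0.021 0.080 0.195 |   -     -     -
  3  2    6   12   2000  | 21.93 (4.20) | 5.80 (2.21) | 0.000 0.000 0.000 0.000 | 0.004 0.015 0.057 0.148 |   -     -     -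
  4  2    8   16   1500  | 23.91 (4.40) | 6.03 (2.28) | 0.000 0.000 0.000 0.000 | 0.001 0.009 0.049 0.137 |   -     -     -
  6  2   12   24    800  | 26.25 (4.61) | 6.10 (2.36) | 0.000 0.000 0.000 0.000 | 0.000 0.006 0.046 0.129 |   -     -     -
  8  2   16   32    400  | 27.89 (4.88) | 6.30 (2.45) | 0.000 0.000 0.000 0.000 | 0.003 0.010 0.050 0.122 |   -     -     -
  1  4    4    8   3000  |  4.96 (2.07) | 2.31 (1.42) | 0.007 0.038 0.111 0.246 | 0.086 0.308 0.590 0.809 | 0.566 0.799 0.934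
  2  4    8   16   1500  |  5.57 (2.22) | 2.37 (1.42) | 0.000 0.021 0.070 0.179 | 0.075 0.287 0.574 0.800 | 0.419 0.848 0.926
  3  4   12   24    800  |  5.78 (2.24) | 2.50 (1.45) | 0.000 0.009 0.066 0.141 | 0.066 0.268 0.531 0.761 | 0.857 0.792 0.903
  4  4   16   32    400  |  6.03 (2.38) | 2.52 (1.54) | 0.003 0.007 0.055 0.102 | 0.077 0.265 0.535 0.757 | 0.667 0.818 1.000
  1  8    8   16   1500  |  2.26 (1.38) | 1.22 (1.03) | 0.087 0.317 0.597 0.823 | 0.263 0.656 0.894 0.977 | 0.557 0.841 0.955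
  2  8   16   32    400  |  2.35 (1.50) | 1.23 (1.09) | 0.100 0.297 0.575 0.797 | 0.278 0.650 0.895 0.963 | 0.605 0.857 0.978

Reading.
* In the premise regime of r3 (aspect l = 4, 8; k = 0, 1, 2) the CONCLUSION probabilities are stable in n:
  P(MinCut(n, 8n) = 0) = 0.086, 0.075, 0.066, 0.077 (n = 1..4); P(MinCut(n, 16n) = 0) = 0.263, 0.278
  (n = 1, 2); P(MinCut(n, 8n) ≤ 1) ≈ 0.27–0.31; while the premise probabilities at aspect l shrink or stay
  (P(MinCut(n,4n) ≤ 1) = 0.038 → 0.007).  So numerically r3 holds with room to spare — c'(k=0, l=4) ≈ 0.07,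
  c'(k=0, l=8) ≈ 0.27, c'(k=1, l=4) ≈ 0.27 — in the only way it can (the conclusion holds REGARDLESS of the
  premise, cf. §3/§4b); the conditionals P(mc2 ≤ k | mc1 ≤ k+1) ≈ 0.4–0.85 (k = 0, few samples) and ≈ 0.8
  (k = 1) show no decay in n.  No trace of the dangerous world (tight budgets with vanishing blocking).
* Budgets versus n at fixed aspect: flat at aspects 8 and 16 (2.26/2.35; 1.22/1.23), slowly increasing at
  aspect 4 (4.84 → 6.30 over n = 1..8) and clearly increasing at aspect 2 (13.3 → 27.9, fitted equally well by
  13 + 7 ln n and by saturation) — at n ≤ 8 the aspect-2 annulus is a few lattice spacings thick, so this is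
  read as a finite-size transient, but a logarithmic drift of MinCut(n, 2n) cannot be excluded by these sizes
  (flag for r2 = BudgetTightness, which only needs ONE aspect: aspects 8–16 look tight).
* Blocking probability increases with the aspect (0.003 at 4, ≈ 0.07 at 8, ≈ 0.27 at 16), as the θ(p_c) = 0
  picture predicts (one-arm decay); supports the target X at aspect ≥ 8 for these n. -/

/-! ## §7 Line `halfspace-polarisation`: the open stub `stub_halfspaceShare` resists exactly like the crux -/

/-- The upper half-box `{v ∈ box 3 L | v₀ ≥ 0}` (the line's canonical front region). [folklore] -/
def halfBox (L : ℕ) : Set (Site 3) := {v : Site 3 | v ∈ box 3 L ∧ 0 ≤ v 0}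

/-- `frontBlocked₀ n L`: NO open path from `box 3 n` to `∂ⁱⁿ box 3 L` inside the upper half-box (VERBATIM the
def-free term of the line's stubs 2 and 3, lead rev 2). [folklore] -/
def frontBlocked₀ (n L : ℕ) : Set (BondConfig (Site 3)) :=
  {ω : BondConfig (Site 3) | ¬ ∃ x ∈ box 3 n, ∃ y ∈ innerBoundary (zdGraph 3) (box 3 L),
    ω ∈ openConnIn {v : Site 3 | v ∈ box 3 L ∧ 0 ≤ v 0} x y}

/-- `frontProb n L = P_{p_c}(frontBlocked₀ n L)`. [folklore] -/
def frontProb (n L : ℕ) : ℝ := μc.real (frontBlocked₀ n L)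

/-- The line's open stub `stub_halfspaceShare`, over the dictionary. [folklore] -/
def HalfspaceShare : Prop :=
  ∀ (k l : ℕ) (c : ℝ), 2 ≤ l → 0 < c → ∃ c₁ : ℝ, 0 < c₁ ∧ ∀ n : ℕ, 1 ≤ n →
    c ≤ blockProb (k + 1 + 1) n (l * n) →
      ∃ L' : ℕ, l * n ≤ L' ∧ L' + n + 1 ≤ 2 * l * n ∧ c₁ ≤ frontProb n L'

/-- `HalfspaceShare` IS the registered stub statement (definitional unfolding). [folklore] -/
theorem halfspaceShare_iff :
    HalfspaceShare ↔
      ∀ (k l : ℕ) (c : ℝ), 2 ≤ l → 0 < c → ∃ c₁ : ℝ, 0 < c₁ ∧ ∀ n : ℕ, 1 ≤ n →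
      c ≤ (bondPercolation (zdGraph 3) (criticalProbI 3)).real
        {ω : BondConfig (Site 3) | ∃ S : Finset (Sym2 (Site 3)), S.card ≤ k + 1 + 1 ∧ ¬ ∃ x ∈ box 3 n, ∃ y ∈ innerBoundary (zdGraph 3) (box 3 (l * n)), (ω \ (↑S : Set (Sym2 (Site 3)))) ∈ openConnIn (↑(box 3 (l * n)) : Set (Site 3)) x y} →
        ∃ L' : ℕ, l * n ≤ L' ∧ L' + n + 1 ≤ 2 * l * n ∧ c₁ ≤ (bondPercolation (zdGraph 3) (criticalProbI 3)).real
          {ω : BondConfig (Site 3) | ¬ ∃ x ∈ box 3 n, ∃ y ∈ innerBoundary (zdGraph 3) (box 3 L'), ω ∈ openConnIn {v : Site 3 | v ∈ box 3 L' ∧ 0 ≤ v 0} x y} :=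
  Iff.rfl

/-! ### §7.1 Elementary facts on `frontBlocked₀` -/

/-- Monotonicity of `openConnIn` in the region (local copy; every configuration). [folklore] -/
theorem openConnIn_mono_region {S T : Set (Site 3)} (hST : S ⊆ T) (x y : Site 3) {ω : BondConfig (Site 3)}
    (h : ω ∈ openConnIn S x y) : ω ∈ openConnIn T x y := by
  obtain ⟨hx, hy, hr⟩ := h
  let φ : ((openGraph ω).induce S) →g ((openGraph ω).induce T) :=
    { toFun := fun v => ⟨v.1, hST v.2⟩
      map_rel' := by
        intro a b hab
        simp only [SimpleGraph.induce_adj] at hab ⊢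
        exact hab }
  exact ⟨hST hx, hST hy, hr.map φ⟩

/-- Full-box blocking implies half-box blocking (pointwise, every configuration). [folklore] -/
theorem blockedEv_zero_subset_frontBlocked₀ (n L : ℕ) : blockedEv 0 n L ⊆ frontBlocked₀ n L := by
  intro ω hω
  rw [blockedEv_zero] at hω
  rintro ⟨x, hx, y, hy, hxy⟩
  exact hω ⟨x, hx, y, hy, openConnIn_mono_region (fun v hv => Finset.mem_coe.2 hv.1) x y hxy⟩

/-- `blockProb 0 n L ≤ frontProb n L`. [folklore] -/
theorem blockProb_zero_le_frontProb (n L : ℕ) : blockProb 0 n L ≤ frontProb n L :=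
  measureReal_mono (blockedEv_zero_subset_frontBlocked₀ n L)

/-- **Finite energy for the half-box**: `0 < frontProb n L` for `n < L` — so per fixed `n` the conclusion of
the open stub is free; its content is uniformity in `n`. [folklore] -/
theorem frontProb_pos {n L : ℕ} (h : n < L) : 0 < frontProb n L :=
  lt_of_lt_of_le (blockProb_pos h) (blockProb_zero_le_frontProb n L)

theorem frontProb_nonneg (n L : ℕ) : 0 ≤ frontProb n L := measureReal_nonneg

theorem frontProb_le_one (n L : ℕ) : frontProb n L ≤ 1 := measureReal_le_one

/-- **Degenerate radius**: for `L ≤ n` the half-box event is EMPTY (the corner `(L,L,L)` of `box L` lies in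
`box n`, in the upper half-box and on `∂ⁱⁿ box L`: a zero-length front crossing).  The stub's guard `l n ≤ L'`
keeps its conclusion away from this regime. [folklore] -/
theorem frontBlocked₀_eq_empty {n L : ℕ} (h : L ≤ n) : frontBlocked₀ n L = ∅ := by
  ext ω
  simp only [frontBlocked₀, Set.mem_setOf_eq, Set.mem_empty_iff_false, iff_false, not_not]
  have hxn : (fun _ => (L : ℤ)) ∈ box 3 n := by
    simp only [mem_box]; intro i; constructor <;> omega
  have hR : (fun _ => (L : ℤ)) ∈ {v : Site 3 | v ∈ box 3 L ∧ 0 ≤ v 0} := by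
    refine ⟨?_, by simp⟩
    simp [mem_box]
  exact ⟨_, hxn, _, corner_mem_innerBoundary L, hR, hR, SimpleGraph.Reachable.refl _⟩

theorem frontProb_eq_zero {n L : ℕ} (h : L ≤ n) : frontProb n L = 0 := by
  simp [frontProb, frontBlocked₀_eq_empty h]

/-! ### §7.2 Resistance: ¬r2 → stub, uniform half-space blocking → stub -/

/-- **¬BudgetTightness → HalfspaceShare.**  If critical budgets are not tight, the premise of the stub at
`(k+2, l, c)` holds for finitely many `n` only, on which `c₁` = a finite minimum of the positive numbers
`frontProb n (2ln - n - 1)` works (`L' = 2ln - n - 1`).  So, like the crux, the open stub can fail only in a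
world where r2 HOLDS (with budget `k + 2` at aspect `l`). [folklore] -/
theorem halfspaceShare_of_not_budgetTightness (hBT : ¬ PercBudgetLadder.BudgetTightness) :
    HalfspaceShare := by
  rw [budgetTightness_iff] at hBT
  push Not at hBT
  intro k l c hl hc
  obtain ⟨N, hN⟩ := hBT (k + 1 + 1) l c hl hc
  have hpos : ∀ n : ℕ, 1 ≤ n → 0 < frontProb n (2 * l * n - n - 1) := by
    intro n hn
    have h2 : 2 * n ≤ l * n := Nat.mul_le_mul_right n hl
    have h3 : 2 * l * n = 2 * (l * n) := by ring
    exact frontProb_pos (by omega)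
  obtain ⟨c₁, hc₁, hmin⟩ := exists_pos_lower_bound (fun n => frontProb n (2 * l * n - n - 1)) hpos N
  refine ⟨c₁, hc₁, fun n hn hprem => ?_⟩
  have hnN : n < N := by
    by_contra hnN
    exact absurd hprem (not_le.2 (hN n (not_lt.1 hnN)))
  have h2 : 2 * n ≤ l * n := Nat.mul_le_mul_right n hl
  have h3 : 2 * l * n = 2 * (l * n) := by ring
  exact ⟨2 * l * n - n - 1, by omega, by omega, hmin n hn hnN⟩

/-- Contrapositive: **a refutation of the open stub is a proof of r2** (`BudgetTightness`). [folklore] -/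
theorem budgetTightness_of_not_halfspaceShare (h : ¬ HalfspaceShare) : PercBudgetLadder.BudgetTightness := by
  by_contra hBT
  exact h (halfspaceShare_of_not_budgetTightness hBT)

/-- Uniform half-space blocking at every aspect `l ≥ 2`: the premise-free statement the stub must stay
below (cf. the dead card `front-blocking-suffices`, whose `C⁺` is this at aspects `≤ 2l`, certified a costume of
uniform RSW in `Cruxes/PinholeClosing/FrontBlockingSufficesNoGo.lean`). [folklore] -/
def UniformHalfspaceBlocking : Prop :=
  ∀ l : ℕ, 2 ≤ l → ∃ c₁ : ℝ, 0 < c₁ ∧ ∀ n : ℕ, 1 ≤ n → c₁ ≤ frontProb n (l * n)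

/-- **Uniform half-space blocking → HalfspaceShare** (premise unused, `L' = l n`). [folklore] -/
theorem halfspaceShare_of_uniform (h : UniformHalfspaceBlocking) : HalfspaceShare := by
  intro k l c hl _
  obtain ⟨c₁, hc₁, hb⟩ := h l hl
  refine ⟨c₁, hc₁, fun n hn _ => ?_⟩
  have h2 : 2 * n ≤ l * n := Nat.mul_le_mul_right n hl
  exact ⟨l * n, le_rfl, by nlinarith, hb n hn⟩

/-- The stub with its PREMISE DROPPED is exactly uniform half-space blocking at some radius in
`[l n, 2 l n - n - 1]` — premise-free, i.e. the costume that killed `front-blocking-suffices`; so the premise is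
load-bearing upward, as for the crux (§2 `pinholeClosingWithoutC_iff`). [folklore] -/
def HalfspaceShareWithoutPremise : Prop :=
  ∀ (k l : ℕ), 2 ≤ l → ∃ c₁ : ℝ, 0 < c₁ ∧ ∀ n : ℕ, 1 ≤ n →
    ∃ L' : ℕ, l * n ≤ L' ∧ L' + n + 1 ≤ 2 * l * n ∧ c₁ ≤ frontProb n L'

theorem halfspaceShareWithoutPremise_of_uniform (h : UniformHalfspaceBlocking) :
    HalfspaceShareWithoutPremise := by
  intro k l hl
  obtain ⟨c₁, hc₁, hb⟩ := h l hl
  refine ⟨c₁, hc₁, fun n hn => ?_⟩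
  have h2 : 2 * n ≤ l * n := Nat.mul_le_mul_right n hl
  exact ⟨l * n, le_rfl, by nlinarith, hb n hn⟩

/-- **Resistance certificate for the open stub**: ¬HalfspaceShare → (r2 ∧ ¬UniformHalfspaceBlocking). [folklore] -/
theorem not_halfspaceShare_imp (h : ¬ HalfspaceShare) :
    PercBudgetLadder.BudgetTightness ∧ ¬ UniformHalfspaceBlocking :=
  ⟨budgetTightness_of_not_halfspaceShare h, fun hu => h (halfspaceShare_of_uniform hu)⟩

/-- **Kill criterion for the open stub.**  It fails iff for some `k, l ≥ 2, c > 0` there are qualifying `n`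
(budget `k+2` at aspect `l` with probability `≥ c`) for which EVERY admissible half-box `A(n, L')`,
`L' ∈ [ln, 2ln - n - 1]`, is front-blocked with arbitrarily small probability; by `frontProb_pos` such `n` are
necessarily unbounded.  Out of reach of finite computation. [folklore] -/
theorem halfspaceShare_kill_criterion (h : ¬ HalfspaceShare) :
    ∃ (k l : ℕ) (c : ℝ), 2 ≤ l ∧ 0 < c ∧ ∀ (N : ℕ) (ε : ℝ), 0 < ε →
      ∃ n : ℕ, N ≤ n ∧ c ≤ blockProb (k + 1 + 1) n (l * n) ∧
        ∀ L' : ℕ, l * n ≤ L' → L' + n + 1 ≤ 2 * l * n → frontProb n L' < ε := by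
  unfold HalfspaceShare at h
  push Not at h
  obtain ⟨k, l, c, hl, hc, hbad⟩ := h
  refine ⟨k, l, c, hl, hc, fun N ε hε => ?_⟩
  have hpos : ∀ n : ℕ, 1 ≤ n → 0 < frontProb n (2 * l * n - n - 1) := by
    intro n hn
    have h2 : 2 * n ≤ l * n := Nat.mul_le_mul_right n hl
    have h3 : 2 * l * n = 2 * (l * n) := by ring
    exact frontProb_pos (by omega)
  obtain ⟨c₁, hc₁, hmin⟩ := exists_pos_lower_bound (fun n => frontProb n (2 * l * n - n - 1)) hpos N
  obtain ⟨n, hn, hprem, hlt⟩ := hbad (min c₁ ε) (lt_min hc₁ hε)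
  have h2 : 2 * n ≤ l * n := Nat.mul_le_mul_right n hl
  have h3 : 2 * l * n = 2 * (l * n) := by ring
  refine ⟨n, ?_, hprem, fun L' h1 h2' => lt_of_lt_of_le (hlt L' h1 h2') (min_le_right _ _)⟩
  by_contra hnN
  have hlo := hmin n hn (not_le.1 hnN)
  have hhi := hlt (2 * l * n - n - 1) (by omega) (by omega)
  exact absurd (lt_of_lt_of_le hhi (min_le_left _ _)) (not_lt.2 hlo)

/-! ### §7.3 The pointwise strengthening of the stub is false (the filament again) -/

theorem pt_mem_halfBox {j L : ℕ} (h : j ≤ L) : pt j ∈ {v : Site 3 | v ∈ box 3 L ∧ 0 ≤ v 0} :=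
  ⟨pt_mem_box h, by simp⟩

/-- The filament is a front-confined crossing: `pt 0 ↔ pt j` inside the upper half-box of `box 3 L`. [folklore] -/
theorem ray_front_reachable (L : ℕ) : ∀ j : ℕ, ∀ hj : j ≤ L,
    ((openGraph ray).induce {v : Site 3 | v ∈ box 3 L ∧ 0 ≤ v 0}).Reachable
      ⟨pt 0, pt_mem_halfBox (Nat.zero_le L)⟩ ⟨pt j, pt_mem_halfBox hj⟩ := by
  intro j
  induction j with
  | zero => intro _; exact SimpleGraph.Reachable.refl _
  | succ j ih =>
    intro hj
    refine (ih (by omega)).trans (SimpleGraph.Adj.reachable ?_)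
    simp only [SimpleGraph.induce_adj, openGraph_adj]
    exact ⟨mem_ray j, pt_ne_succ j⟩

/-- The filament is never front-blocked (`n ≤ L`). [folklore] -/
theorem ray_notMem_frontBlocked₀ {n L : ℕ} (_h : n ≤ L) : ray ∉ frontBlocked₀ n L := by
  intro hb
  exact hb ⟨pt 0, pt_mem_box (Nat.zero_le n), pt L, pt_mem_innerBoundary L,
    pt_mem_halfBox (Nat.zero_le L), pt_mem_halfBox le_rfl, ray_front_reachable L L le_rfl⟩

/-- The configuration-by-configuration strengthening of the open stub. [folklore] -/
def PointwiseHalfspaceShare : Prop :=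
  ∀ (k l : ℕ), 2 ≤ l → ∀ (ω : BondConfig (Site 3)) (n : ℕ), 1 ≤ n →
    ω ∈ blockedEv (k + 1 + 1) n (l * n) → ∃ L' : ℕ, l * n ≤ L' ∧ L' + n + 1 ≤ 2 * l * n ∧ ω ∈ frontBlocked₀ n L'

/-- **The pointwise strengthening of the stub is false** (witness `ray`, k = 0, l = 2, n = 1: budget 1 ≤ 2 at
aspect 2, yet a front-confined crossing of every half-box). [folklore] -/
theorem not_pointwiseHalfspaceShare : ¬ PointwiseHalfspaceShare := by
  intro h
  obtain ⟨L', h1, -, hmem⟩ := h 0 2 le_rfl ray 1 le_rfl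
    (blockedEv_mono_budget (by norm_num : 1 ≤ 0 + 1 + 1) 1 (2 * 1) (ray_mem_blockedEv_one (by norm_num)))
  exact ray_notMem_frontBlocked₀ (by omega) hmem

/-! ### §7.4 WLOG the largest admissible radius: `frontProb n L` is a.s. monotone in `L` -/

/-- The FRONT PART of a configuration: its pairs with both endpoints in the upper half-space `{v₀ ≥ 0}`.
A front-confined open path of `ω` is an open path of `frontPart ω`, and conversely every open path of
`frontPart ω` of positive length is front-confined. [folklore] -/
def frontPart (ω : BondConfig (Site 3)) : BondConfig (Site 3) := {e | e ∈ ω ∧ ∀ v ∈ e, (0 : ℤ) ≤ v 0}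

theorem frontPart_subset (ω : BondConfig (Site 3)) : frontPart ω ⊆ ω := fun _ he => he.1

/-- **Aspect monotonicity of half-box blocking (a.s.).**  On lattice configurations, a front-confined crossing
of `A(n, L')` contains an initial front-confined crossing of `A(n, L)` for `n ≤ L ≤ L'` (first exit from `box L`;
lattice steps needed: a non-lattice jump could leave `box L` without touching `∂ⁱⁿ box L`). [folklore] -/
theorem frontBlocked₀_mono_aspect {n L L' : ℕ} (hnL : n ≤ L) (hL : L ≤ L') {ω : BondConfig (Site 3)}
    (hω : ω ⊆ (zdGraph 3).edgeSet) (h : ω ∈ frontBlocked₀ n L) : ω ∈ frontBlocked₀ n L' := by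
  rcases hL.eq_or_lt with rfl | hLL
  · exact h
  rintro ⟨x, hx, y, hy, hxR', hyR', hr⟩
  apply h
  -- the front part of ω, an honest subgraph of ℤ³
  set H : SimpleGraph (Site 3) := openGraph (frontPart ω) with hH
  have hHle : H ≤ zdGraph 3 := fun a b hab => hω ((openGraph_adj _ _ _).1 hab).1.1
  -- Step 1–2: the front-confined crossing is an H-walk
  let ψ : ((openGraph ω).induce {v : Site 3 | v ∈ box 3 L' ∧ 0 ≤ v 0}) →g H :=
    { toFun := fun v => v.1
      map_rel' := by
        intro a b hab
        simp only [SimpleGraph.induce_adj, openGraph_adj] at hab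
        rw [hH, openGraph_adj]
        refine ⟨⟨hab.1, fun v hv => ?_⟩, hab.2⟩
        rcases Sym2.mem_iff.1 hv with rfl | rfl
        · exact a.2.2
        · exact b.2.2 }
  obtain ⟨w⟩ := hr
  have hyL : y ∉ box 3 L := notMem_box_of_mem_innerBoundary hLL hy
  obtain ⟨b, hb, hxL, hbL, hreach⟩ :=
    exists_innerBoundary_reachable_of_walk hHle (box 3 L) (w.map ψ) (box_mono 3 hnL hx) hyL
  -- Step 3: an H-walk inside box L from the front vertex x is a front-confined ω-walk
  have hxR : x ∈ {v : Site 3 | v ∈ box 3 L ∧ 0 ≤ v 0} := ⟨box_mono 3 hnL hx, hxR'.2⟩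
  have key : ∀ v : (↑(box 3 L) : Set (Site 3)), (H.induce (↑(box 3 L) : Set (Site 3))).Reachable ⟨x, hxL⟩ v →
      ∃ hv : (v : Site 3) ∈ {v : Site 3 | v ∈ box 3 L ∧ 0 ≤ v 0},
        ((openGraph ω).induce {v : Site 3 | v ∈ box 3 L ∧ 0 ≤ v 0}).Reachable ⟨x, hxR⟩ ⟨v, hv⟩ := by
    intro v hv
    rw [SimpleGraph.reachable_iff_reflTransGen] at hv
    induction hv with
    | refl => exact ⟨hxR, SimpleGraph.Reachable.refl _⟩
    | @tail c d _ hcd ih =>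
      obtain ⟨hc, hrc⟩ := ih
      simp only [SimpleGraph.induce_adj] at hcd
      rw [hH, openGraph_adj] at hcd
      obtain ⟨⟨hcdω, hfront⟩, hne⟩ := hcd
      have hd : (d : Site 3) ∈ {v : Site 3 | v ∈ box 3 L ∧ 0 ≤ v 0} :=
        ⟨Finset.mem_coe.1 d.2, hfront _ (Sym2.mem_mk_right _ _)⟩
      refine ⟨hd, hrc.trans (SimpleGraph.Adj.reachable ?_)⟩
      simp only [SimpleGraph.induce_adj, openGraph_adj]
      exact ⟨hcdω, hne⟩
  obtain ⟨hbR, hreach'⟩ := key ⟨b, hbL⟩ hreach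
  exact ⟨x, hx, b, hb, hxR, hbR, hreach'⟩

/-- `frontProb n L ≤ frontProb n L'` for `n ≤ L ≤ L'`. [folklore] -/
theorem frontProb_mono_aspect {n L L' : ℕ} (hnL : n ≤ L) (hL : L ≤ L') : frontProb n L ≤ frontProb n L' :=
  real_mono_of_lattice fun _ hω h => frontBlocked₀_mono_aspect hnL hL hω h

/-- The open stub at the LARGEST admissible radius `L' = 2ln - n - 1` only. [folklore] -/
def HalfspaceShareTop : Prop :=
  ∀ (k l : ℕ) (c : ℝ), 2 ≤ l → 0 < c → ∃ c₁ : ℝ, 0 < c₁ ∧ ∀ n : ℕ, 1 ≤ n →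
    c ≤ blockProb (k + 1 + 1) n (l * n) → c₁ ≤ frontProb n (2 * l * n - n - 1)

/-- **WLOG `L' = 2ln - n - 1`**: the `∃ L'` of the open stub may be fixed at the largest admissible radius (a.s.
aspect monotonicity), so the stub is ONE half-box blocking bound per `n`. [folklore] -/
theorem halfspaceShare_iff_top : HalfspaceShare ↔ HalfspaceShareTop := by
  constructor
  · intro h k l c hl hc
    obtain ⟨c₁, hc₁, H⟩ := h k l c hl hc
    refine ⟨c₁, hc₁, fun n hn hprem => ?_⟩
    obtain ⟨L', h1, h2, hle⟩ := H n hn hprem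
    have h3 : 2 * n ≤ l * n := Nat.mul_le_mul_right n hl
    have h4 : 2 * l * n = 2 * (l * n) := by ring
    exact hle.trans (frontProb_mono_aspect (by omega) (by omega))
  · intro h k l c hl hc
    obtain ⟨c₁, hc₁, H⟩ := h k l c hl hc
    refine ⟨c₁, hc₁, fun n hn hprem => ?_⟩
    have h3 : 2 * n ≤ l * n := Nat.mul_le_mul_right n hl
    have h4 : 2 * l * n = 2 * (l * n) := by ring
    exact ⟨2 * l * n - n - 1, by omega, by omega, H n hn hprem⟩

/-- Under uniform half-space blocking at aspect `2l - 1 - 1/n ≥ l`, i.e. `UniformHalfspaceBlocking`, even the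
TOP form holds premise-free (monotonicity from `l n` up to `2ln - n - 1`). [folklore] -/
theorem halfspaceShareTop_of_uniform (h : UniformHalfspaceBlocking) : HalfspaceShareTop :=
  halfspaceShare_iff_top.1 (halfspaceShare_of_uniform h)

/-! ### §7.5 The lead's mechanism `EccentricShare` has the same resistance shape

`polarBlocked₀ n K L` = "the annulus `A(n, L)` is blocked inside `box L` by closing `≤ K` edges each having an
endpoint STRICTLY BEHIND the plane `{v₀ = 0}`" (the skeleton's `polarBlocked 0 1 0 n K L` up to its `image (· + 0)`
bookkeeping).  A budget-0 blocked annulus is polar-blocked with `S = ∅`, so `EccentricShare₀` (the skeleton's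
`EccentricShare`, centred form) is implied by uniform budget-0 blocking at aspect `l` (premise unused) and by ¬r2
(premise eventually false, finite energy) — exactly like the stub and the crux: its content, too, lives only in the
world "tight budgets ∧ vanishing blocking along a subsequence". -/

/-- Back-polarised budget-`K` blocking of the centred annulus `A(n, L)`. [folklore] -/
def polarBlocked₀ (n K L : ℕ) : Set (BondConfig (Site 3)) :=
  {ω | ∃ S : Finset (Sym2 (Site 3)), S.card ≤ K ∧ (∀ e ∈ S, ∃ v ∈ e, v 0 ≤ -1) ∧
    ¬ ∃ x ∈ box 3 n, ∃ y ∈ innerBoundary (zdGraph 3) (box 3 L), (ω \ ↑S) ∈ openConnIn ↑(box 3 L) x y}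

/-- Budget-0 blocking is polar blocking (`S = ∅`). [folklore] -/
theorem blockedEv_zero_subset_polarBlocked₀ (n K L : ℕ) : blockedEv 0 n L ⊆ polarBlocked₀ n K L := by
  intro ω hω
  rw [blockedEv_zero] at hω
  refine ⟨∅, by simp, by simp, ?_⟩
  simpa using hω

/-- Polar blocking at budget `K` is budget-`K` blocking (forget the polarisation). [folklore] -/
theorem polarBlocked₀_subset_blockedEv (n K L : ℕ) : polarBlocked₀ n K L ⊆ blockedEv K n L :=
  fun _ ⟨S, hS, _, hb⟩ => ⟨S, hS, hb⟩

/-- The skeleton's `EccentricShare`, centred form. [folklore] -/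
def EccentricShare₀ : Prop :=
  ∀ (k l : ℕ) (c : ℝ), 2 ≤ l → 0 < c → ∃ c₁ : ℝ, 0 < c₁ ∧ ∀ n : ℕ, 1 ≤ n →
    c ≤ blockProb (k + 1 + 1) n (l * n) →
      ∃ L' : ℕ, l * n ≤ L' ∧ L' + n + 1 ≤ 2 * l * n ∧ c₁ ≤ μc.real (polarBlocked₀ n (k + 1 + 1) L')

/-- **Uniform budget-0 blocking at aspect `l` → EccentricShare₀** (premise unused, `L' = l n`, `S = ∅`). [folklore] -/
theorem eccentricShare₀_of_uniform_blocking
    (h : ∀ l : ℕ, 2 ≤ l → ∃ c₁ : ℝ, 0 < c₁ ∧ ∀ n : ℕ, 1 ≤ n → c₁ ≤ blockProb 0 n (l * n)) :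
    EccentricShare₀ := by
  intro k l c hl _
  obtain ⟨c₁, hc₁, hb⟩ := h l hl
  refine ⟨c₁, hc₁, fun n hn _ => ?_⟩
  have h2 : 2 * n ≤ l * n := Nat.mul_le_mul_right n hl
  exact ⟨l * n, le_rfl, by nlinarith,
    (hb n hn).trans (measureReal_mono (blockedEv_zero_subset_polarBlocked₀ n _ (l * n)))⟩

/-- **¬BudgetTightness → EccentricShare₀** (premise eventually false; finite energy via `S = ∅`). [folklore] -/
theorem eccentricShare₀_of_not_budgetTightness (hBT : ¬ PercBudgetLadder.BudgetTightness) : EccentricShare₀ := by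
  rw [budgetTightness_iff] at hBT
  push Not at hBT
  intro k l c hl hc
  obtain ⟨N, hN⟩ := hBT (k + 1 + 1) l c hl hc
  have hpos : ∀ n : ℕ, 1 ≤ n → 0 < μc.real (polarBlocked₀ n (k + 1 + 1) (2 * l * n - n - 1)) := by
    intro n hn
    have h2 : 2 * n ≤ l * n := Nat.mul_le_mul_right n hl
    have h3 : 2 * l * n = 2 * (l * n) := by ring
    exact lt_of_lt_of_le (blockProb_pos (k := 0) (by omega))
      (measureReal_mono (blockedEv_zero_subset_polarBlocked₀ n _ _))
  obtain ⟨c₁, hc₁, hmin⟩ :=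
    exists_pos_lower_bound (fun n => μc.real (polarBlocked₀ n (k + 1 + 1) (2 * l * n - n - 1))) hpos N
  refine ⟨c₁, hc₁, fun n hn hprem => ?_⟩
  have hnN : n < N := by
    by_contra hnN
    exact absurd hprem (not_le.2 (hN n (not_lt.1 hnN)))
  have h2 : 2 * n ≤ l * n := Nat.mul_le_mul_right n hl
  have h3 : 2 * l * n = 2 * (l * n) := by ring
  exact ⟨2 * l * n - n - 1, by omega, by omega, hmin n hn hnN⟩

/-- **EccentricShare₀ sits between the stub's two drivers**: it is implied by uniform blocking and by ¬r2, and
(by `polarBlocked_subset_frontBlocked` in the skeleton) implies the stub.  So refuting the MECHANISM is no easier than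
refuting the stub: ¬EccentricShare₀ → r2 ∧ ¬(uniform budget-0 blocking at every aspect l ≥ 2). [folklore] -/
theorem not_eccentricShare₀_imp (h : ¬ EccentricShare₀) :
    PercBudgetLadder.BudgetTightness ∧
      ¬ ∀ l : ℕ, 2 ≤ l → ∃ c₁ : ℝ, 0 < c₁ ∧ ∀ n : ℕ, 1 ≤ n → c₁ ≤ blockProb 0 n (l * n) :=
  ⟨by_contra fun hBT => h (eccentricShare₀_of_not_budgetTightness hBT),
   fun hu => h (eccentricShare₀_of_uniform_blocking hu)⟩

end

end Summit.CriticalPhenomena.PercolationContinuityZ3.Cruxes.PinholeClosing.Disproof
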